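import Summits.ResolutionOfSingularities.ResolutionOfSingularities.Theorems.FrobeniusLadderFInjectiveMacaulayficationMonomialFloorClassRow
import HarnessLib

/-!
# THE TRANSPORT COROLLARY: a floor `I` of `V(f)` that becomes an `𝔪`-primary MONOMIAL ideal under a coordinate change `φ` fixing the origin, with `φ f` convenient and weakly
# non-degenerate, is CURED — conditional on `F108ConsumableRel`; so GAP-1 shrinks (conditionally) to «admissible centres not monomialisable by a WND-preserving automorphism»
# (crux `FInjectiveMacaulayfication` stmt-ResolutionOfSingularities-15315, chain w45a; res-L1-w45a-plan-1 ACK 01:17Z queue (2) / RULING R22.21 (4) «the TRANSPORT COROLLARY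
# `autMonomialFloorCured_of_F108ConsumableRel`: for a k-algebra automorphism σ of k[X] with σ(𝔪) = 𝔪, if σ(I) is 𝔪-primary MONOMIAL and σ(f) is convenient-WND with x̄ᵢ ≠ 0 and
# regular off v, then every blowing up along Ĩ is cured — one application of (B‴) + transport stated for a general floor (generalise the transport letter from 𝔪̃ to Ĩ if it is
# point-floor-specific; say so)»; seat res-L1-w45a-stub-1 g14; sequel of ✓ `…MonomialFloorClassRow` (p685336), ✓ `…GermRowTransport` (p678337), ✓ `…PolyAutRowTransport` (p678625))

[OURS · L1 W4.5a] Support file (`--supports stmt-ResolutionOfSingularities-15315 --as helper`); def-free; §1–§2 UNCONDITIONAL transport lemmas; §3 CONDITIONAL on the named OURS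
hypothesis `MonomialFloorClassRow.F108ConsumableRel k n` (binder `hF`). Nothing of the crux is proved. AI-written (AI review is weaker than expert review).

WHAT HAD TO BE GENERALISED (and is said here, per the ruling): ✓ `GermRowTransport.rowShape_transport` / `rowShape_of_ringEquiv` are ALREADY stated for an arbitrary centre `I`
(not only `𝔪̃`), but for the THREE-conjunct census letter ⟨LEGAL, NOT FULL, CURED⟩; the monomial-floor theorem delivers the CURED conjunct alone, so §1 is the CURED-only twin
(`curedShape_transport`, `curedShape_of_ringEquiv` — same proof, third conjunct). ✓ `PolyAutRowTransport.exists_quotientEquiv` exposes the induced `τ : k[X]/(φ f) ≃ k[X]/(f)` only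
through its action on the origin ideal; §2 `exists_quotientEquiv_map` re-derives it WITH its action on every ideal `(J mod φ f) ↦ (φ⁻¹ J mod f)`.
* §1 `curedShape_transport`, `curedShape_of_ringEquiv`.
* §2 `exists_quotientEquiv_map`.
* §3 ★★ `autMonomialFloorCured_of_F108ConsumableRel` — `F108ConsumableRel k n →` for a ring automorphism `φ` of `k[X]` with `φ(Xᵢ)`, `φ⁻¹(Xᵢ)` constant-term-free, `g = φ f` prime,
  convenient, weakly non-degenerate along every positive weight, `x̄ᵢ ≠ 0` in `k[X]/(g)`, `V(g)` regular off the origin (`k = k̄`, char `p`), and an ideal `I ⊆ k[X]` with `φ(I) = (x^B)`,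
  `B` containing a positive pure power of every variable: EVERY blowing up of `Spec 𝒪_{V(f),v}` along `Ĩ = (I mod f)~` is CURED (`∃ 𝓚 ≠ ⊥` fibre-supported, all blowings up FULL).
  Says nothing about admissibility / NOT-FULLness of the floor `I` (per floor). Q17 arm B therefore hunts for admissible centres OUTSIDE this corollary.
[folklore transport + conditional class theorem; cite: GortzWedhorn2020, (13.19); IshiiSingularities2018, Thm. 4.4.23; StacksProject, Tag 01J7]
-/

-- single-problem summit: the doubled namespace component is forced
set_option linter.dupNamespace false

noncomputable section

namespace Summit.ResolutionOfSingularities.ResolutionOfSingularities.Theorems.FInjectiveMacaulayfication.AutMonomialFloorCured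

open CategoryTheory CategoryTheory.Limits AlgebraicGeometry TopologicalSpace IsLocalRing MvPolynomial
open Literature.AlgebraicGeometry.Resolution Literature.AlgebraicGeometry.Resolution.BoubakriGreuelMarkwig
open Summit.ResolutionOfSingularities.ResolutionOfSingularities.Theorems.FInjectiveMacaulayfication
open SliceableCentre GermForm GermRowTransport

/-! ## §1 The CURED conjunct transports along an isomorphism of germs -/

/-- **CURED transports along an isomorphism of germs** fixing the closed points and matching the centres (`J′.comap Φ = J`): the third conjunct of ✓ `rowShape_transport`, alone.
[folklore; cite: GortzWedhorn2020, (13.19)] -/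
theorem curedShape_transport (p : ℕ) {X X' : Scheme.{0}} {x : X} {x' : X'} (Φ : Spec (X.presheaf.stalk x) ≅ Spec (X'.presheaf.stalk x'))
    (hΦ : Φ.hom.base (closedPoint (X.presheaf.stalk x)) = closedPoint (X'.presheaf.stalk x'))
    (J : (Spec (X.presheaf.stalk x)).IdealSheafData) (J' : (Spec (X'.presheaf.stalk x')).IdealSheafData) (hJ : J'.comap Φ.hom = J)
    (h : ∀ (S' : Scheme.{0}) (g : S' ⟶ Spec (X.presheaf.stalk x)), IsBlowup g J →
      ∃ 𝓚 : S'.IdealSheafData, 𝓚 ≠ ⊥ ∧ (∀ s ∈ (𝓚.support : Set S'), g.base s = closedPoint (X.presheaf.stalk x)) ∧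
        ∀ (S'' : Scheme.{0}) (π : S'' ⟶ S'), IsBlowup π 𝓚 → ∀ s : S'', FullCl p (S''.presheaf.stalk s)) :
    ∀ (S' : Scheme.{0}) (g' : S' ⟶ Spec (X'.presheaf.stalk x')), IsBlowup g' J' →
      ∃ 𝓚 : S'.IdealSheafData, 𝓚 ≠ ⊥ ∧ (∀ s ∈ (𝓚.support : Set S'), g'.base s = closedPoint (X'.presheaf.stalk x')) ∧
        ∀ (S'' : Scheme.{0}) (π : S'' ⟶ S'), IsBlowup π 𝓚 → ∀ s : S'', FullCl p (S''.presheaf.stalk s) := by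
  intro S' g' hg'
  have hg : IsBlowup (g' ≫ Φ.inv) J := by
    have := hg'.comp_iso Φ.symm
    rw [show Φ.symm.inv = Φ.hom from rfl, hJ] at this
    exact this
  obtain ⟨𝓚, h𝓚, h𝓚supp, h𝓚full⟩ := h S' (g' ≫ Φ.inv) hg
  have hpt : ∀ s : S', (g' ≫ Φ.inv).base s = closedPoint (X.presheaf.stalk x) ↔ g'.base s = closedPoint (X'.presheaf.stalk x') := fun s => by
    rw [Scheme.Hom.comp_apply]
    exact inv_base_eq_closedPoint_iff Φ hΦ (g'.base s)
  exact ⟨𝓚, h𝓚, fun s hs => (hpt s).mp (h𝓚supp s hs), h𝓚full⟩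

/-- **CURED along a ring isomorphism** `τ : A ≃+* A′`, `x′ ∈ Spec A′`, `I ⊆ A`: cured for `(Spec A, I~)` at `(Spec τ) x′` ⇒ cured for `(Spec A′, (τ I)~)` at `x′`. [folklore] -/
theorem curedShape_of_ringEquiv (p : ℕ) {A A' : Type} [CommRing A] [CommRing A'] (τ : A ≃+* A') (x' : Spec (.of A')) (I : Ideal A)
    (h : ∀ (S' : Scheme.{0}) (g : S' ⟶ Spec ((Spec (.of A)).presheaf.stalk ((Spec.map (CommRingCat.ofHom τ.toRingHom)).base x'))),
      IsBlowup g ((affineBlowup.idealSheaf I).comap ((Spec (.of A)).fromSpecStalk ((Spec.map (CommRingCat.ofHom τ.toRingHom)).base x'))) →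
      ∃ 𝓚 : S'.IdealSheafData, 𝓚 ≠ ⊥ ∧ (∀ s ∈ (𝓚.support : Set S'), g.base s = closedPoint _) ∧
        ∀ (S'' : Scheme.{0}) (π : S'' ⟶ S'), IsBlowup π 𝓚 → ∀ s : S'', FullCl p (S''.presheaf.stalk s)) :
    ∀ (S' : Scheme.{0}) (g' : S' ⟶ Spec ((Spec (.of A')).presheaf.stalk x')),
      IsBlowup g' ((affineBlowup.idealSheaf (I.map τ.toRingHom)).comap ((Spec (.of A')).fromSpecStalk x')) →
      ∃ 𝓚 : S'.IdealSheafData, 𝓚 ≠ ⊥ ∧ (∀ s ∈ (𝓚.support : Set S'), g'.base s = closedPoint _) ∧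
        ∀ (S'' : Scheme.{0}) (π : S'' ⟶ S'), IsBlowup π 𝓚 → ∀ s : S'', FullCl p (S''.presheaf.stalk s) := by
  obtain ⟨Φ, hΦ, hJ⟩ := exists_germIso_specMap τ x' I
  exact curedShape_transport p Φ hΦ _ _ hJ h

/-! ## §2 The induced isomorphism of coordinate rings, with its action on every ideal -/

variable (k : Type) [Field k] {n : ℕ}

/-- For `φ f = g` with `φ(Xᵢ)`, `φ⁻¹(Xᵢ)` constant-term-free: a ring isomorphism `τ : k[X]/(g) ≃+* k[X]/(f)` (induced by `φ⁻¹`) with `τ (J mod g) = (φ⁻¹ J) mod f` for EVERY ideal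
`J ⊆ k[X]`, mapping the origin ideal onto the origin ideal, hence `(Spec τ)(v′) =` the origin of `V(g)` for `v′` the origin of `V(f)`. (✓ `PolyAutRowTransport.exists_quotientEquiv`
re-derived with the general mapping clause.) [folklore] -/
theorem exists_quotientEquiv_map (φ : MvPolynomial (Fin n) k ≃+* MvPolynomial (Fin n) k)
    (h₁ : ∀ i : Fin n, constantCoeff (φ (X i)) = 0) (h₂ : ∀ i : Fin n, constantCoeff (φ.symm (X i)) = 0)
    (f g : MvPolynomial (Fin n) k) (hfg : φ f = g) :
    ∃ τ : (MvPolynomial (Fin n) k ⧸ Ideal.span {g}) ≃+* (MvPolynomial (Fin n) k ⧸ Ideal.span {f}),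
      (∀ J : Ideal (MvPolynomial (Fin n) k), (J.map (Ideal.Quotient.mk (Ideal.span {g}))).map τ.toRingHom =
        (J.map φ.symm.toRingHom).map (Ideal.Quotient.mk (Ideal.span {f}))) ∧
      (Ideal.span (Set.range fun j : Fin n => Ideal.Quotient.mk (Ideal.span {g}) (X j))).map τ.toRingHom =
        Ideal.span (Set.range fun j : Fin n => Ideal.Quotient.mk (Ideal.span {f}) (X j)) ∧
      ∀ v' : Spec (.of (MvPolynomial (Fin n) k ⧸ Ideal.span {f})),
        v'.asIdeal = Ideal.span (Set.range fun j : Fin n => Ideal.Quotient.mk (Ideal.span {f}) (X j)) →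
        ((Spec.map (CommRingCat.ofHom τ.toRingHom)).base v').asIdeal = Ideal.span (Set.range fun j : Fin n => Ideal.Quotient.mk (Ideal.span {g}) (X j)) := by
  have hIJ : Ideal.span {f} = (Ideal.span {g}).map (φ.symm : MvPolynomial (Fin n) k →+* MvPolynomial (Fin n) k) := by
    rw [Ideal.map_span, Set.image_singleton]
    congr 1
    rw [Set.singleton_eq_singleton_iff, ← hfg]
    exact (φ.symm_apply_apply f).symm
  let τ : (MvPolynomial (Fin n) k ⧸ Ideal.span {g}) ≃+* (MvPolynomial (Fin n) k ⧸ Ideal.span {f}) := Ideal.quotientEquiv _ _ φ.symm hIJ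
  have hτmk : τ.toRingHom.comp (Ideal.Quotient.mk (Ideal.span {g})) = (Ideal.Quotient.mk (Ideal.span {f})).comp φ.symm.toRingHom := by
    refine RingHom.ext fun q => ?_
    rfl
  have hJ : ∀ J : Ideal (MvPolynomial (Fin n) k), (J.map (Ideal.Quotient.mk (Ideal.span {g}))).map τ.toRingHom =
      (J.map φ.symm.toRingHom).map (Ideal.Quotient.mk (Ideal.span {f})) := fun J => by
    rw [Ideal.map_map, hτmk, ← Ideal.map_map]
  have horig : ∀ h : MvPolynomial (Fin n) k, Ideal.span (Set.range fun j : Fin n => Ideal.Quotient.mk (Ideal.span {h}) (X j)) =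
      (MvPolynomial.idealOfVars (Fin n) k).map (Ideal.Quotient.mk (Ideal.span {h})) := fun h => by
    rw [MvPolynomial.idealOfVars, Ideal.map_span, ← Set.range_comp]
    rfl
  have hmap : (Ideal.span (Set.range fun j : Fin n => Ideal.Quotient.mk (Ideal.span {g}) (X j))).map τ.toRingHom =
      Ideal.span (Set.range fun j : Fin n => Ideal.Quotient.mk (Ideal.span {f}) (X j)) := by
    rw [horig g, horig f, hJ, PolyAutRowTransport.map_idealOfVars_eq k φ.symm h₂ (by simpa using h₁)]
  refine ⟨τ, hJ, hmap, fun v' hv' => ?_⟩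
  rw [Spec.map_apply, CommRingCat.hom_ofHom, PrimeSpectrum.comap_asIdeal, hv', ← hmap]
  exact Ideal.comap_map_of_bijective τ.toRingHom τ.bijective

/-! ## §3 ★★ The transport corollary -/

set_option maxHeartbeats 800000 in
-- large statement only
/-- ★★ **A FLOOR THAT IS MONOMIAL IN WND COORDINATES IS CURED, CONDITIONAL ON `F108ConsumableRel k n`.** Let `φ` be a ring automorphism of `k[X₀..X_{n−1}]` (`n ≥ 1`, `k = k̄`, char `p`)
with `φ(Xᵢ)`, `φ⁻¹(Xᵢ)` constant-term-free, `g = φ f` PRIME, CONVENIENT, WEAKLY NON-DEGENERATE along every positive weight, `x̄ᵢ ≠ 0` in `k[X]/(g)`, `V(g)` regular off the origin; let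
`I ⊆ k[X]` be an ideal with `φ(I) = (x^B)`, `B` a finite exponent set with a positive pure power of every variable. Then for EVERY blowing up `S′ → Spec 𝒪_{V(f),v}` of the germ of
`V(f)` at the origin along the floor `(I mod f)~` there is `𝓚 ≠ ⊥` on `S′`, supported over the closed point, ALL of whose blowings up are FULL at every stalk. ONE application of
✓ `MonomialFloorClassRow.monomialFloorCured_of_F108ConsumableRel` to `(g, B)` and §1–§2. Says nothing about admissibility or non-FULLness of the floor.
[OURS · conditional; cite: IshiiSingularities2018, Thm. 4.4.23; GortzWedhorn2020, (13.19)] -/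
theorem autMonomialFloorCured_of_F108ConsumableRel (p : ℕ) [Fact p.Prime] [IsAlgClosed k] [CharP k p] (hF : MonomialFloorClassRow.F108ConsumableRel k n) (hn : 0 < n)
    (φ : MvPolynomial (Fin n) k ≃+* MvPolynomial (Fin n) k)
    (h₁ : ∀ i : Fin n, constantCoeff (φ (X i)) = 0) (h₂ : ∀ i : Fin n, constantCoeff (φ.symm (X i)) = 0)
    (f g : MvPolynomial (Fin n) k) (hfg : φ f = g) (hgp : Prime g)
    (hconv : ∀ j : Fin n, ∃ N : ℕ, 0 < N ∧ MvPolynomial.coeff (Finsupp.single j N) g ≠ 0)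
    (hWND : ∀ w : Fin n → ℝ, (∀ i, 0 < w i) → IsWeaklyNondegenerateAlong w (g : MvPowerSeries (Fin n) k))
    (hXne : ∀ v : Fin n, Ideal.Quotient.mk (Ideal.span {g}) (X v) ≠ 0)
    (hreg : ∀ x : Spec (.of (MvPolynomial (Fin n) k ⧸ Ideal.span {g})),
      ¬ Ideal.span (Set.range fun j : Fin n => Ideal.Quotient.mk (Ideal.span {g}) (X j)) ≤ x.asIdeal → IsRegularLocalRing (Localization.AtPrime x.asIdeal))
    (I : Ideal (MvPolynomial (Fin n) k)) (B : Finset (Fin n →₀ ℕ)) (hB : ∀ j : Fin n, ∃ N : ℕ, 0 < N ∧ Finsupp.single j N ∈ B)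
    (hI : I.map φ.toRingHom = Ideal.span ((fun e : Fin n →₀ ℕ => (monomial e (1 : k) : MvPolynomial (Fin n) k)) '' (B : Set (Fin n →₀ ℕ))))
    (v' : Spec (.of (MvPolynomial (Fin n) k ⧸ Ideal.span {f})))
    (hv' : v'.asIdeal = Ideal.span (Set.range fun j : Fin n => Ideal.Quotient.mk (Ideal.span {f}) (X j))) :
    ∀ (S' : Scheme.{0}) (gS : S' ⟶ Spec ((Spec (.of (MvPolynomial (Fin n) k ⧸ Ideal.span {f}))).presheaf.stalk v')),
      IsBlowup gS ((affineBlowup.idealSheaf (I.map (Ideal.Quotient.mk (Ideal.span {f})))).comap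
        ((Spec (.of (MvPolynomial (Fin n) k ⧸ Ideal.span {f}))).fromSpecStalk v')) →
      ∃ 𝓚 : S'.IdealSheafData, 𝓚 ≠ ⊥ ∧
        (∀ s ∈ (𝓚.support : Set S'), gS.base s = closedPoint ((Spec (.of (MvPolynomial (Fin n) k ⧸ Ideal.span {f}))).presheaf.stalk v')) ∧
        ∀ (S'' : Scheme.{0}) (π : S'' ⟶ S'), IsBlowup π 𝓚 → ∀ s : S'', FullCl p (S''.presheaf.stalk s) := by
  obtain ⟨τ, hJ, -, horig⟩ := exists_quotientEquiv_map k φ h₁ h₂ f g hfg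
  -- the monomial floor of `V(g)`, as the image of `(x^B) ⊆ k[X]`
  set I₀ : Ideal (MvPolynomial (Fin n) k ⧸ Ideal.span {g}) :=
    (Ideal.span ((fun e : Fin n →₀ ℕ => (monomial e (1 : k) : MvPolynomial (Fin n) k)) '' (B : Set (Fin n →₀ ℕ)))).map (Ideal.Quotient.mk (Ideal.span {g})) with hI₀
  have hI₀' : I₀ = Ideal.span ((fun e : Fin n →₀ ℕ => Ideal.Quotient.mk (Ideal.span {g}) (monomial e (1 : k))) '' (B : Set (Fin n →₀ ℕ))) := by
    rw [hI₀, Ideal.map_span, Set.image_image]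
  -- (B‴) at the origin of `V(g)`, which is `(Spec τ) v′`
  have hcured := MonomialFloorClassRow.monomialFloorCured_of_F108ConsumableRel k p hF hn g hgp hconv hWND hXne hreg B hB
    ((Spec.map (CommRingCat.ofHom τ.toRingHom)).base v') (horig v' hv')
  rw [← hI₀'] at hcured
  -- transport along `τ`; `τ I₀ = (φ⁻¹ (x^B)) mod f = I mod f`
  have hII : (I.map φ.toRingHom).map φ.symm.toRingHom = I := by
    rw [Ideal.map_map]
    have : φ.symm.toRingHom.comp φ.toRingHom = RingHom.id _ := RingHom.ext fun q => by simp
    rw [this, Ideal.map_id]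
  have hmapI : I₀.map τ.toRingHom = I.map (Ideal.Quotient.mk (Ideal.span {f})) := by
    rw [hI₀, hJ, ← hI, hII]
  have h := curedShape_of_ringEquiv p τ v' I₀ hcured
  rw [hmapI] at h
  exact h

end Summit.ResolutionOfSingularities.ResolutionOfSingularities.Theorems.FInjectiveMacaulayfication.AutMonomialFloorCured

end
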